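/- Copyright: the b2b-balaban cell (near-miss cell 7), T⁴-continuum fan-out, lineage t4-ne7b-p1 (node U5c COUNT
member; row NE7b owner, M5-2 «the witness plug»).  Released under the licence of the surrounding project. -/
import Summits.QuantumFields.BalabanUV.T4Continuum.Support.HistoryConstantsTHTotal
import Summits.QuantumFields.BalabanUV.T4Continuum.Support.HistoryBankingVolumePlug

/-!
# Printed-currency price readings AT `κ := costT` WITH BOTH SLACK FACTORS give the model-currency reading — the
assembly socket of INTERFACE REQUEST NE7b IR-44-1 (owner module of row NE7b, lineage `t4-ne7b-p1` gen 44; re-open object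
(α), `SCOPE-alpha.md` v2.7; M5-2 «the witness plug», END socket; PRE-POSITIONING ONLY)

Summits-side support leaf of the T⁴-continuum cell (rung (B)+1 on a FINITE torus only; NOT infinite volume, NOT the
mass gap, NOT the Clay statement; NOT a proof of the spine estimate NE7b — the cell's OWN estimate, NOT PRINTED, NOT
PROVED).  [folklore] composition by name of `HistoryBankingVolumePlug.le_prod_shapeTH_of_slack_weighted` (p263135) with
the assembly's member price `HistoryAssemblyTerms.priceT` (`HistoryAssemblyPrice.priceT_eq_cshapeTH`), in the shape of
leaf-04's `HistoryAssemblyPrice.hprice_of_printed_slack(_total)`; nothing printed is asserted, no `def`, no cite-tagged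
hypothesis, zero `sorry`.

WHY.  The W-T END (`HistoryRealiseCellsRunMultWT` → `…MultEndWT` → `…PinnedT3bWT` → `…HeadlineT3bWT`) turns the witness's
printed-currency price sentence `priceM` (per bad term: live price × resummation ≤ `∏_q pshapeTH … (κ K q) q.2 · e^{−Ξ}`)
and the slot multiplicity's class-linear factor `e^{θ·birthLinT}` into the model-currency member prices `∏_q priceT …`
through `hprice_of_printed_slack(_total)`, spending print's birth-credit room `C.a + θ ≤ ½γ₀A₁²`.  The `κ := costT` witness
(`HistoryRealiseCellsRunApexT3bWTV.CountRoadWitnessT3bWTV`, p263890) drops the realised cost; M5-2 (rows S19∕S20) supplies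
the live VOLUME factor inside `e^{+lifeCost (costT) q.2}` up to the weighted class remainder `e^{birthWT Prod.fst (uᵥ K) q.2}`
(`uᵥ K = 2^{d+3}·log Λ K`).  THIS FILE is the socket the END twin of IR-44-1 calls in place of `hprice_of_printed_slack_total`:
both factors at once, the room SPLIT `C.a + (θ + θᵥ) ≤ ½γ₀A₁²`, the remainder's display `uᵥ K j ≤ θᵥ·p₀(g_K j)²` at the
births, NO realised-cost binder.

WHAT.  **`hprice_of_printed_slack_weighted_costT`**: if, for every `K ≥ K₀`, `|t| ≤ l₀` and bad term `τ`,
`Fc · Rf ≤ ∏_{q ∈ mem K τ} pshapeTH sh O C 1 Λ′ (R K) (g K) 0 (costT sh C K (R K)) q.2 · e^{θ·birthLinT sh q.2} · e^{birthWT sh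
(uᵥ K) q.2}`, the profile is `≥ 1` and `uᵥ K j ≤ θᵥ·p₀(g_K j)²` at the members' birth steps, `θ ≥ 0` and `C.a + (θ + θᵥ) ≤
½γ₀A₁²`, then `Fc · Rf ≤ ∏_{q ∈ mem K τ} priceT sh C Λ′ R g K q`.  **`hprice_of_printed_weighted_costT`**: the same without
the class-linear factor (`θ = 0`: the END variants that do not display the slot multiplicity's slack).

HONEST: bookkeeping; by-name effect NONE until the END twin consumes it; NE7b NOT proved; spine 0∕9.  HONEST DEPENDENCY
(cell): continuum YM on T⁴ ⇐ BetaPertH ∧ nine spine estimates (0∕9 proved); BetaPertH ⇐ (D1) ∧ (D4) ∧ CAP+tail.  This file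
changes none of it.
-/

open Finset
open Literature.MathematicalPhysics.QuantumFieldTheory.Balaban1983to89
open T4PersistenceDictionary T4PersistentHistoryCount T4BankedInduction T4PrintedShapeBanking T4PartnerMultiplicity
open T4TaggedShapeBanking T4BranchingRecordsGas
open Summit.QuantumFields.BalabanUV.T4Continuum.LateMergers
open Summit.QuantumFields.BalabanUV.T4Continuum.HistoryConstants
open Summit.QuantumFields.BalabanUV.T4Continuum.HistoryGen
open Summit.QuantumFields.BalabanUV.T4Continuum.HistoryAssemblyTerms
open Summit.QuantumFields.BalabanUV.T4Continuum.HistoryBankingVolumePlug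

namespace Summit.QuantumFields.BalabanUV.T4Continuum.HistoryAssemblyPrice

noncomputable section

section PrintedWeighted

variable {ε γ ι : Type*} [DecidableEq ε] [DecidableEq γ] {C : T4PrintedShapeBanking.Consts} {O : PrintedO1s}

/-- **PRINTED PRICES AT `κ := costT` WITH BOTH SLACK FACTORS GIVE THE MODEL-CURRENCY READING** (the socket of INTERFACE
REQUEST NE7b IR-44-1): per bad term, a live price below `∏_q pshapeTH … (costT …) q.2 · e^{θ·birthLinT sh q.2} · e^{birthWT
sh (uᵥ K) q.2}` — print's credits, the model's own booked life cost in the exponent, the slot multiplicity's class-linear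
factor AND the volume remainder's weighted class factor — is below `∏_q priceT …`, under the SPLIT room `C.a + (θ + θᵥ) ≤
½γ₀A₁²` (`θ ≥ 0`), the profile floor `≥ 1` and the weight display `uᵥ K j ≤ θᵥ·p₀(g_K j)²` at the members' birth steps; NO
realised-cost binder (`κ := costT`, `le_rfl`). [folklore] -/
theorem hprice_of_printed_slack_weighted_costT (sh : ε → PEv) {θ θv : ℝ} (hθ : 0 ≤ θ)
    (hslack : C.a + (θ + θv) ≤ O.γ₀ * O.A₁ ^ 2 / 2) {Λ' : ℝ} (hΛ : 0 ≤ Λ') (R : ℕ → ℕ → ℕ) (g : ℕ → ℕ → ℝ)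
    {l₀ : ℝ} {K₀ : ℕ} {T : ℕ → Finset ι} {mem : ℕ → ι → Finset (γ × Gen ε)} {jstar : ℕ → ℕ}
    {Fc Rf : ℕ → Finset (BSlot γ PEv) → ℝ}
    (hP1 : ∀ K, K₀ ≤ K → ∀ τ ∈ badTerms mem jstar T K, ∀ q ∈ mem K τ,
      ∀ e ∈ q.2.events, (sh e).kind = 0 → 1 ≤ p0Profile C.A₀ C.p₀ (g K (sh e).step))
    (uV : ℕ → ℕ → ℝ)
    (huV : ∀ K, K₀ ≤ K → ∀ τ ∈ badTerms mem jstar T K, ∀ q ∈ mem K τ,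
      ∀ e ∈ q.2.events, (sh e).kind = 0 → uV K (sh e).step ≤ θv * p0Profile C.A₀ C.p₀ (g K (sh e).step) ^ 2)
    (hP : ∀ K t, |t| ≤ l₀ → K₀ ≤ K → ∀ τ ∈ badTerms mem jstar T K,
      Fc K (HistorySocketTH.bstrOf sh mem K τ) * Rf K (HistorySocketTH.bstrOf sh mem K τ) ≤
        ∏ q ∈ mem K τ, pshapeTH sh O C 1 Λ' (R K) (g K) 0 (costT sh C K (R K)) q.2 *
          Real.exp (θ * birthLinT sh q.2) * Real.exp (birthWT sh (uV K) q.2)) :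
    ∀ K t, |t| ≤ l₀ → K₀ ≤ K → ∀ τ ∈ badTerms mem jstar T K,
      Fc K (HistorySocketTH.bstrOf sh mem K τ) * Rf K (HistorySocketTH.bstrOf sh mem K τ) ≤
        ∏ q ∈ mem K τ, priceT sh C Λ' R g K q := by
  intro K t ht hK τ hτ
  have hx : Fc K (HistorySocketTH.bstrOf sh mem K τ) * Rf K (HistorySocketTH.bstrOf sh mem K τ) ≤
      ∏ q ∈ mem K τ, 1 * (pshapeTH sh O C 1 Λ' (R K) (g K) 0 (costT sh C K (R K)) q.2 *
        Real.exp (θ * birthLinT sh q.2) * Real.exp (birthWT sh (uV K) q.2)) := by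
    simpa only [one_mul] using hP K t ht hK τ hτ
  have h := le_prod_shapeTH_of_slack_weighted sh hθ hslack zero_le_one hΛ (R K) (g K) K 0 (mem K τ) (fun q => q.2)
    (mult := fun _ => 1) (fun _ _ => zero_le_one) (fun _ => costT sh C K (R K)) (fun q => uV K) (hP1 K hK τ hτ)
    (huV K hK τ hτ) (fun _ _ _ _ => le_rfl) hx
  simpa only [one_mul, priceT_eq_cshapeTH] using h

/-- **… WITHOUT THE CLASS-LINEAR FACTOR** (`θ = 0`): a live price below `∏_q pshapeTH … (costT …) q.2 · e^{birthWT sh (uᵥ K)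
q.2}` is below `∏_q priceT …` under `C.a + θᵥ ≤ ½γ₀A₁²` and the weight display — for END variants that do not display the
slot multiplicity's slack. [folklore] -/
theorem hprice_of_printed_weighted_costT (sh : ε → PEv) {θv : ℝ} (hslack : C.a + θv ≤ O.γ₀ * O.A₁ ^ 2 / 2)
    {Λ' : ℝ} (hΛ : 0 ≤ Λ') (R : ℕ → ℕ → ℕ) (g : ℕ → ℕ → ℝ) {l₀ : ℝ} {K₀ : ℕ} {T : ℕ → Finset ι}
    {mem : ℕ → ι → Finset (γ × Gen ε)} {jstar : ℕ → ℕ} {Fc Rf : ℕ → Finset (BSlot γ PEv) → ℝ} (uV : ℕ → ℕ → ℝ)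
    (huV : ∀ K, K₀ ≤ K → ∀ τ ∈ badTerms mem jstar T K, ∀ q ∈ mem K τ,
      ∀ e ∈ q.2.events, (sh e).kind = 0 → uV K (sh e).step ≤ θv * p0Profile C.A₀ C.p₀ (g K (sh e).step) ^ 2)
    (hP : ∀ K t, |t| ≤ l₀ → K₀ ≤ K → ∀ τ ∈ badTerms mem jstar T K,
      Fc K (HistorySocketTH.bstrOf sh mem K τ) * Rf K (HistorySocketTH.bstrOf sh mem K τ) ≤
        ∏ q ∈ mem K τ, pshapeTH sh O C 1 Λ' (R K) (g K) 0 (costT sh C K (R K)) q.2 *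
          Real.exp (birthWT sh (uV K) q.2)) :
    ∀ K t, |t| ≤ l₀ → K₀ ≤ K → ∀ τ ∈ badTerms mem jstar T K,
      Fc K (HistorySocketTH.bstrOf sh mem K τ) * Rf K (HistorySocketTH.bstrOf sh mem K τ) ≤
        ∏ q ∈ mem K τ, priceT sh C Λ' R g K q := by
  intro K t ht hK τ hτ
  have hx : Fc K (HistorySocketTH.bstrOf sh mem K τ) * Rf K (HistorySocketTH.bstrOf sh mem K τ) ≤
      ∏ q ∈ mem K τ, 1 * (pshapeTH sh O C 1 Λ' (R K) (g K) 0 (costT sh C K (R K)) q.2 *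
        Real.exp (birthWT sh (uV K) q.2)) := by
    simpa only [one_mul] using hP K t ht hK τ hτ
  have h : Fc K (HistorySocketTH.bstrOf sh mem K τ) * Rf K (HistorySocketTH.bstrOf sh mem K τ) ≤
      ∏ q ∈ mem K τ, 1 * shapeTH sh C 1 Λ' (R K) (g K) K 0 q.2 :=
    hx.trans (prod_le_prod
      (fun q _ => mul_nonneg zero_le_one (mul_nonneg (pshapeTH_nonneg sh zero_le_one hΛ (R K) (g K) 0 _ _)
        (Real.exp_pos _).le))
      fun q hq => mul_le_mul_of_nonneg_left
        (pshapeTH_mul_exp_le_shapeTH_of_weighted sh hslack zero_le_one hΛ (R K) (g K) K 0 (huV K hK τ hτ q hq)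
          (fun _ _ => le_rfl)) zero_le_one)
  simpa only [one_mul, priceT_eq_cshapeTH] using h

end PrintedWeighted

end

end Summit.QuantumFields.BalabanUV.T4Continuum.HistoryAssemblyPrice
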